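import Mathlib
import HarnessLib
import Literature.Geometry.Manifold.FlowBoxFlow
import Literature.Geometry.Lorentzian.KillingFlowIsometry
import Literature.Geometry.Lorentzian.IPlusRegular
import Literature.Geometry.Lorentzian.StationaryBlackHoleUniquenessProofs

/-!
# A field commuting with `V` on a `V`-invariant open set is invariant under the flow of `V`
# (crux `NonTrappingHawkingRigidity`, stmt-FinalStateConjecture-13896, line `Sketch`, stub S3 helper)

Local form of Lee 2012, Thm. 9.42 (`[V, W] = 0` iff `W` is invariant under the flow of `V`), for a
field `W` which is only given on an OPEN SET `D`: if `V` is a `C^∞` field with a `C²` flow `θ`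
(group law), `D` is open and invariant under the flow, `V` has no zero on `D`, and `W` is `C^∞` on
`D` with `[V, W] = 0` on `D`, then `dθ_t (W p) = W (θ_t p)` for all `p ∈ D` and all `t`
(`mfderiv_flow_apply_eq_of_invariant`). The tree proves the statement for GLOBAL fields
(`Literature.Geometry.Lorentzian.eventually_mfderiv_flow_apply_eq_of_ne_zero`,
`mfderiv_flow_apply_eq_of_ne_zero`, file `KillingAlgebraAsymptoticallyFlatProofs`); the proofs here
are the same, localised: a flow box of `V` inside `D` (`exists_chart_mfderiv_eq_const`,
`exists_nhds_flow_eq_symm_add_smul`), naturality of the bracket in the box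
(`mpullback_mlieBracket`: the representative `Ŵ` of `W` is constant along the straightened flow
lines), and propagation along the orbit (the set of good times is clopen). Application
(`stub_slabPatching_flowInvariance`): a local `T`-commuting Killing field on a `T`-invariant open
subset of the d.o.c. of an `I⁺`-regular stationary black hole is invariant under the stationary
flow (`T ≠ 0` on the d.o.c., Chruściel–Costa 2008, Cor. 3.8, tree theorem
`IsIPlusRegular.killing_ne_zero_of_mem_doc`). Everything is proved; no definitions.
-/

noncomputable section

-- D-0017: single-problem summit, `Summit.<S>.<S>.…` by design
set_option linter.dupNamespace false

namespace Summit.FinalStateConjecture.FinalStateConjecture.Theorems.NonTrappingHawkingRigidity.AzimuthalPartialAnalyticity.SlabPatching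

open Set Filter Function Bundle VectorField Literature.Geometry.Manifold Literature.Geometry.Lorentzian
open scoped Manifold ContDiff Topology

variable {E : Type*} [NormedAddCommGroup E] [NormedSpace ℝ E] [CompleteSpace E]
  {M : Type*} [TopologicalSpace M] [ChartedSpace E M] [IsManifold 𝓘(ℝ, E) ∞ M] [T2Space M]
  {V W : Π x : M, TangentSpace 𝓘(ℝ, E) x} {θ : ℝ × M → M}

/-- **Local invariance at a regular point, for a field given on an open set** (Lee 2012,
Thm. 9.42, localised): `V` a `C^∞` field with flow `θ` (`θ(0, ·) = id`, `t ↦ θ(t, p)` integral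
curves), `D` open, `W` of class `C^∞` on `D` with `[V, W] = 0` on `D`; then at every `p ∈ D` with
`V p ≠ 0`, `dθ_t (W p) = W (θ_t p)` for all small `t`. Proof as for the tree's global
`eventually_mfderiv_flow_apply_eq_of_ne_zero`, in a flow box of `V` contained in `D`.
[cite: LeeSmoothManifolds2013, Thm. 9.42] -/
theorem eventually_mfderiv_flow_apply_eq_of_ne_zero_of_isOpen
    (hV : ContMDiff 𝓘(ℝ, E) 𝓘(ℝ, E).tangent ∞ (fun x ↦ (⟨x, V x⟩ : TangentBundle 𝓘(ℝ, E) M)))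
    {D : Set M} (hD : IsOpen D)
    (hW : ContMDiffOn 𝓘(ℝ, E) 𝓘(ℝ, E).tangent ∞
      (fun x ↦ (⟨x, W x⟩ : TangentBundle 𝓘(ℝ, E) M)) D)
    (hVW : ∀ x ∈ D, mlieBracket 𝓘(ℝ, E) V W x = 0)
    (hθV : ∀ p, IsMIntegralCurve (fun t ↦ θ (t, p)) V) (hθ0 : ∀ p, θ (0, p) = p)
    {p : M} (hpD : p ∈ D) (hp : V p ≠ 0) :
    ∀ᶠ t in 𝓝 (0 : ℝ),
      mfderiv 𝓘(ℝ, E) 𝓘(ℝ, E) (fun q ↦ θ (t, q)) p (W p) = W (θ (t, p)) := by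
  -- a flow box of `V` about `p` inside `D`
  obtain ⟨ψ, hψ, hpψ, hψD, hψV, hψv⟩ :=
    exists_chart_mfderiv_eq_const (V := V) hD (hV.contMDiffOn (s := D)) hpD hp
  have hV1 : ContMDiff 𝓘(ℝ, E) 𝓘(ℝ, E).tangent 1
      (fun x ↦ (⟨x, V x⟩ : TangentBundle 𝓘(ℝ, E) M)) := hV.of_le (by exact_mod_cast le_top)
  obtain ⟨ε, hε, N, hNo, hpN, hNψ, hbox⟩ := exists_nhds_flow_eq_symm_add_smul hψ hψv hV1 hθV hθ0 hpψ
  set v : E := (show E from V p) with hv_def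
  have hWat : ∀ x ∈ ψ.source, ContMDiffAt 𝓘(ℝ, E) 𝓘(ℝ, E).tangent ∞
      (fun x ↦ (⟨x, W x⟩ : TangentBundle 𝓘(ℝ, E) M)) x := fun x hx ↦
    (hW x (hψD hx)).contMDiffAt (hD.mem_nhds (hψD hx))
  -- smoothness of `ψ`, `ψ⁻¹` and the mutual inverse differentials
  have hψt : ∀ q ∈ ψ.target, ContMDiffAt 𝓘(ℝ, E) 𝓘(ℝ, E) ∞ ψ.symm q := fun q hq ↦
    (contMDiffOn_symm_of_mem_maximalAtlas hψ).contMDiffAt (ψ.open_target.mem_nhds hq)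
  have hψd : ψ.MDifferentiable 𝓘(ℝ, E) 𝓘(ℝ, E) :=
    ⟨(contMDiffOn_of_mem_maximalAtlas hψ).mdifferentiableOn (by simp),
      (contMDiffOn_symm_of_mem_maximalAtlas hψ).mdifferentiableOn (by simp)⟩
  have hinv : ∀ x ∈ ψ.source,
      (mfderiv 𝓘(ℝ, E) 𝓘(ℝ, E) ψ.symm (ψ x)).inverse = mfderiv 𝓘(ℝ, E) 𝓘(ℝ, E) ψ x := by
    intro x hx
    refine ContinuousLinearMap.inverse_eq (hψd.symm_comp_deriv hx) ?_
    have h := hψd.comp_symm_deriv (ψ.map_source hx)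
    rwa [ψ.left_inv hx] at h
  have hInv : ∀ q ∈ ψ.target, (mfderiv 𝓘(ℝ, E) 𝓘(ℝ, E) ψ.symm q).IsInvertible := by
    intro q hq
    refine ContinuousLinearMap.IsInvertible.of_inverse
      (g := mfderiv 𝓘(ℝ, E) 𝓘(ℝ, E) ψ (ψ.symm q)) ?_ (hψd.comp_symm_deriv hq)
    have h := hψd.symm_comp_deriv (ψ.map_target hq)
    rwa [ψ.right_inv hq] at h
  -- the chart representatives: `V̂ ≡ v`, `Ŵ = (ψ⁻¹)^* W`
  have hVhat : ∀ q ∈ ψ.target, mpullback 𝓘(ℝ, E) 𝓘(ℝ, E) ψ.symm V q = v := by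
    intro q hq
    have hx : ψ.symm q ∈ ψ.source := ψ.map_target hq
    have h1 := hinv (ψ.symm q) hx
    rw [ψ.right_inv hq] at h1
    rw [mpullback_apply, h1]
    exact hψV (ψ.symm q) hx
  set What : E → E := fun q ↦ mpullback 𝓘(ℝ, E) 𝓘(ℝ, E) ψ.symm W q with hWhat_def
  have hWhat : ∀ x ∈ ψ.source, What (ψ x) = mfderiv 𝓘(ℝ, E) 𝓘(ℝ, E) ψ x (W x) := by
    intro x hx
    simp only [hWhat_def, mpullback_apply]
    rw [hinv x hx, ψ.left_inv hx]
  have hWhat_smooth : ∀ q ∈ ψ.target, ContDiffAt ℝ 1 What q := by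
    intro q hq
    have h := ContMDiffAt.mpullback_vectorField_preimage (I := 𝓘(ℝ, E)) (I' := 𝓘(ℝ, E))
      (m := 1) (n := ∞) ((hWat _ (ψ.map_target hq)).of_le (by exact_mod_cast le_top))
      (hψt q hq) (hInv q hq) (WithTop.coe_le_coe.2 le_top)
    exact contMDiffAt_vectorSpace_iff_contDiffAt.1 h
  -- `[V, W] = 0` read in the box: `DŴ · v = 0` on the target
  haveI : IsManifold 𝓘(ℝ, E) (minSmoothness ℝ 2) M := by
    rw [minSmoothness_of_isRCLikeNormedField]
    infer_instance
  have hbr : ∀ q ∈ ψ.target, fderiv ℝ What q v = 0 := by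
    intro q hq
    have hxD : ψ.symm q ∈ D := hψD (ψ.map_target hq)
    have key := mpullback_mlieBracket (I := 𝓘(ℝ, E)) (I' := 𝓘(ℝ, E)) (f := ψ.symm) (V := V)
      (W := W) (x₀ := q) ((hV _).mdifferentiableAt (by simp))
      ((hWat _ (ψ.map_target hq)).mdifferentiableAt (by simp))
      (hψt q hq) (by
        rw [minSmoothness_of_isRCLikeNormedField]
        exact (ENat.LEInfty.out : (2 : ℕ∞ω) ≤ ∞))
    rw [mpullback_apply, hVW _ hxD, map_zero, ← mlieBracketWithin_univ,
      mlieBracketWithin_eq_lieBracketWithin, lieBracketWithin_univ] at key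
    have hV' : (fun q ↦ mpullback 𝓘(ℝ, E) 𝓘(ℝ, E) ψ.symm V q) =ᶠ[𝓝 q] fun _ ↦ v := by
      filter_upwards [ψ.open_target.mem_nhds hq] with q' hq' using hVhat q' hq'
    rw [hV'.lieBracket_vectorField_eq EventuallyEq.rfl] at key
    simp only [lieBracket, fderiv_fun_const, Pi.zero_apply, zero_apply, sub_zero] at key
    exact key.symm
  -- translation invariance of `Ŵ` along the segment `ψ p + s v`, `|s| < ε`
  have hseg : ∀ s ∈ Ioo (-ε) ε, ψ p + s • v ∈ ψ.target := fun s hs ↦ (hbox p hpN s hs).1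
  have hderiv : ∀ s ∈ Ioo (-ε) ε, HasDerivAt (fun s : ℝ ↦ What (ψ p + s • v)) (0 : E) s := by
    intro s hs
    have h1 : HasDerivAt (fun s : ℝ ↦ ψ p + s • v) v s := by
      simpa using ((hasDerivAt_id s).smul_const v).const_add (ψ p)
    have h2 : HasFDerivAt What (fderiv ℝ What (ψ p + s • v)) (ψ p + s • v) :=
      ((hWhat_smooth _ (hseg s hs)).differentiableAt one_ne_zero).hasFDerivAt
    have h3 := h2.comp_hasDerivAt s h1
    rwa [hbr _ (hseg s hs)] at h3
  have hconst : ∀ s ∈ Ioo (-ε) ε, What (ψ p + s • v) = What (ψ p) := by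
    intro s hs
    have h0 : (0 : ℝ) ∈ Ioo (-ε) ε := ⟨by linarith, hε⟩
    have key := (convex_Ioo (-ε) ε).is_const_of_fderivWithin_eq_zero (𝕜 := ℝ)
      (f := fun s : ℝ ↦ What (ψ p + s • v))
      (fun s hs ↦ (hderiv s hs).differentiableAt.differentiableWithinAt)
      (fun s hs ↦ by
        rw [fderivWithin_of_isOpen isOpen_Ioo hs, (hderiv s hs).hasFDerivAt.fderiv]
        ext
        simp) hs h0
    simpa using key
  -- conclusion, for `|t| < ε`
  filter_upwards [Ioo_mem_nhds (neg_lt_zero.2 hε) hε] with t ht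
  obtain ⟨hq, -, hθeq, -⟩ := hbox p hpN t ht
  have hev : (fun q ↦ θ (t, q)) =ᶠ[𝓝 p] fun q ↦ ψ.symm (ψ q + t • v) := by
    filter_upwards [hNo.mem_nhds hpN] with x hx using (hbox x hx t ht).2.2.1
  rw [hev.mfderiv_eq]
  have h1 : HasMFDerivAt 𝓘(ℝ, E) 𝓘(ℝ, E) ψ p (mfderiv 𝓘(ℝ, E) 𝓘(ℝ, E) ψ p) :=
    (hψd.mdifferentiableAt hpψ).hasMFDerivAt
  have h2 : HasMFDerivAt 𝓘(ℝ, E) 𝓘(ℝ, E) (fun q : E ↦ q + t • v) (ψ p)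
      (ContinuousLinearMap.id ℝ (TangentSpace 𝓘(ℝ, E) (ψ p))) :=
    hasMFDerivAt_iff_hasFDerivAt.2 ((hasFDerivAt_id _).add_const _)
  have h3 : HasMFDerivAt 𝓘(ℝ, E) 𝓘(ℝ, E) ψ.symm (ψ p + t • v)
      (mfderiv 𝓘(ℝ, E) 𝓘(ℝ, E) ψ.symm (ψ p + t • v)) :=
    (hψd.mdifferentiableAt_symm hq).hasMFDerivAt
  have hcomp : HasMFDerivAt 𝓘(ℝ, E) 𝓘(ℝ, E) (fun q ↦ ψ.symm (ψ q + t • v)) p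
      ((mfderiv 𝓘(ℝ, E) 𝓘(ℝ, E) ψ.symm (ψ p + t • v)).comp
        ((ContinuousLinearMap.id ℝ (TangentSpace 𝓘(ℝ, E) (ψ p))).comp
          (mfderiv 𝓘(ℝ, E) 𝓘(ℝ, E) ψ p))) :=
    h3.comp p (h2.comp p h1)
  rw [hcomp.mfderiv]
  change mfderiv 𝓘(ℝ, E) 𝓘(ℝ, E) ψ.symm (ψ p + t • v) (mfderiv 𝓘(ℝ, E) 𝓘(ℝ, E) ψ p (W p)) =
    W (θ (t, p))
  rw [← hWhat p hpψ, ← hconst t ht, hθeq]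
  simp only [hWhat_def, mpullback_apply]
  have h := ContinuousLinearMap.ext_iff.1 (hInv _ hq).self_comp_inverse
    (W (ψ.symm (ψ p + t • v)))
  simpa using h

/-- **Invariance along the orbits in an invariant open set** (Lee 2012, Thm. 9.42, localised):
under the hypotheses of `eventually_mfderiv_flow_apply_eq_of_ne_zero_of_isOpen`, for a `C²` flow
`θ` with the group law, an open set `D` invariant under the flow on which `V` has no zero, and
`W` of class `C^∞` on `D` with `[V, W] = 0` on `D`: `dθ_t (W p) = W (θ_t p)` for ALL `t` and all
`p ∈ D`. The set of good times is closed (two continuous curves in the Hausdorff `TM`; the orbit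
stays in `D`, where `W` is continuous) and open (at a good time `t₀`, `θ_t = θ_{t-t₀} ∘ θ_{t₀}`
and the local statement applies at `θ_{t₀} p ∈ D`). [cite: LeeSmoothManifolds2013, Thm. 9.42] -/
theorem mfderiv_flow_apply_eq_of_invariant
    (hV : ContMDiff 𝓘(ℝ, E) 𝓘(ℝ, E).tangent ∞ (fun x ↦ (⟨x, V x⟩ : TangentBundle 𝓘(ℝ, E) M)))
    {D : Set M} (hD : IsOpen D)
    (hW : ContMDiffOn 𝓘(ℝ, E) 𝓘(ℝ, E).tangent ∞
      (fun x ↦ (⟨x, W x⟩ : TangentBundle 𝓘(ℝ, E) M)) D)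
    (hVW : ∀ x ∈ D, mlieBracket 𝓘(ℝ, E) V W x = 0)
    (hθ : ContMDiff (𝓘(ℝ, ℝ).prod 𝓘(ℝ, E)) 𝓘(ℝ, E) 2 θ)
    (hθV : ∀ p, IsMIntegralCurve (fun t ↦ θ (t, p)) V) (hθ0 : ∀ p, θ (0, p) = p)
    (hθadd : ∀ t s p, θ (t, θ (s, p)) = θ (t + s, p))
    (hDinv : ∀ p ∈ D, ∀ t : ℝ, θ (t, p) ∈ D) (hVne : ∀ p ∈ D, V p ≠ 0)
    {p : M} (hpD : p ∈ D) (t : ℝ) :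
    mfderiv 𝓘(ℝ, E) 𝓘(ℝ, E) (fun q ↦ θ (t, q)) p (W p) = W (θ (t, p)) := by
  set S : Set ℝ :=
    {t | mfderiv 𝓘(ℝ, E) 𝓘(ℝ, E) (fun q ↦ θ (t, q)) p (W p) = W (θ (t, p))} with hS
  suffices h : S = univ by
    have ht : t ∈ S := h ▸ mem_univ t
    exact ht
  haveI : T2Space (TangentBundle 𝓘(ℝ, E) M) := t2Space_totalSpace
  refine IsClopen.eq_univ ⟨?_, ?_⟩ ⟨0, ?_⟩
  · -- closed: equaliser of two continuous curves in `TM`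
    have hF : Continuous fun t : ℝ ↦
        (TotalSpace.mk' E (θ (t, p)) (mfderiv 𝓘(ℝ, E) 𝓘(ℝ, E) (fun q ↦ θ (t, q)) p (W p)) :
          TangentBundle 𝓘(ℝ, E) M) :=
      PseudoRiemannianMetric.continuous_lift_mfderiv_flow hθ p (W p)
    have horb : Continuous fun t : ℝ ↦ θ (t, p) :=
      hθ.continuous.comp (continuous_id.prodMk continuous_const)
    have hG : Continuous fun t : ℝ ↦
        (TotalSpace.mk' E (θ (t, p)) (W (θ (t, p))) : TangentBundle 𝓘(ℝ, E) M) :=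
      (hW.continuousOn.comp_continuous horb fun t ↦ hDinv p hpD t)
    have hcl := isClosed_eq hF hG
    convert hcl using 1
    ext t
    simp only [hS, mem_setOf_eq, TotalSpace.mk_inj]
  · -- open: propagate from a good time `t₀` by the local statement at `θ (t₀, p)`
    rw [isOpen_iff_mem_nhds]
    intro t₀ ht₀
    have hA := eventually_mfderiv_flow_apply_eq_of_ne_zero_of_isOpen hV hD hW hVW hθV hθ0
      (hDinv p hpD t₀) (hVne _ (hDinv p hpD t₀))
    have hT : Tendsto (fun t : ℝ ↦ t - t₀) (𝓝 t₀) (𝓝 0) := by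
      have h : Tendsto (fun t : ℝ ↦ t - t₀) (𝓝 t₀) (𝓝 (t₀ - t₀)) :=
        tendsto_id.sub tendsto_const_nhds
      rwa [sub_self] at h
    filter_upwards [hT.eventually hA] with t ht
    have ht₀' : mfderiv 𝓘(ℝ, E) 𝓘(ℝ, E) (fun q ↦ θ (t₀, q)) p (W p) = W (θ (t₀, p)) := ht₀
    show mfderiv 𝓘(ℝ, E) 𝓘(ℝ, E) (fun q ↦ θ (t, q)) p (W p) = W (θ (t, p))
    have hfun : (fun q ↦ θ (t, q)) = (fun q ↦ θ (t - t₀, q)) ∘ (fun q ↦ θ (t₀, q)) := by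
      funext q
      simp [hθadd]
    have hd1 := PseudoRiemannianMetric.mdifferentiableAt_flow hθ (t - t₀) (θ (t₀, p))
    have hd2 := PseudoRiemannianMetric.mdifferentiableAt_flow hθ t₀ p
    rw [hfun, mfderiv_comp p hd1 hd2]
    change mfderiv 𝓘(ℝ, E) 𝓘(ℝ, E) (fun q ↦ θ (t - t₀, q)) (θ (t₀, p))
      (mfderiv 𝓘(ℝ, E) 𝓘(ℝ, E) (fun q ↦ θ (t₀, q)) p (W p)) = W (θ (t, p))
    rw [ht₀', ht, hθadd, sub_add_cancel]
  · show mfderiv 𝓘(ℝ, E) 𝓘(ℝ, E) (fun q ↦ θ (0, q)) p (W p) = W (θ (0, p))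
    have hid : (fun q ↦ θ (0, q)) = id := funext hθ0
    rw [hid, mfderiv_id]
    change W p = W (θ (0, p))
    rw [hθ0]

/-- **Registered form (sub-goal `stub_slabPatching_flowInvariance` of stub S3 `stub_slabPatching`):
a local `T`-commuting Killing-type field on a `T`-invariant open subset of the d.o.c. of an
`I⁺`-regular stationary black hole is invariant under the stationary flow.** For any smooth flow
`θ` of `T = 𝓑.killing` with the group law, an open `D ⊆ ⟨⟨M_ext⟩⟩` invariant under `θ`, and `L`
of class `C^∞` on `D` with `[T, L] = 0` on `D`: `dθ_t (L p) = L (θ_t p)` for `p ∈ D`, all `t`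
(`mfderiv_flow_apply_eq_of_invariant`; `T ≠ 0` on the d.o.c. by `I⁺`-regularity,
Chruściel–Costa 2008, Cor. 3.8, `IsIPlusRegular.killing_ne_zero_of_mem_doc`).
[cite: LeeSmoothManifolds2013, Thm. 9.42] -/
theorem stub_slabPatching_flowInvariance :
    ∀ (𝓑 : StationaryAFBlackHole.{0}) [𝓑.metric.HasLeviCivita], 𝓑.IsIPlusRegular →
      ∀ (θ : ℝ × 𝓑.carrier → 𝓑.carrier) (D : Set 𝓑.carrier)
        (L : Π x : 𝓑.carrier, TangentSpace (𝓡 4) x),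
      ContMDiff (𝓘(ℝ, ℝ).prod (𝓡 4)) (𝓡 4) ((⊤ : ℕ∞) : WithTop ℕ∞) θ →
      (∀ p, θ (0, p) = p) → (∀ t s p, θ (t, θ (s, p)) = θ (t + s, p)) →
      (∀ p, IsMIntegralCurve (fun t ↦ θ (t, p)) 𝓑.killing) →
      IsOpen D → D ⊆ 𝓑.doc → (∀ p ∈ D, ∀ t : ℝ, θ (t, p) ∈ D) →
      ContMDiffOn (𝓡 4) ((𝓡 4).prod 𝓘(ℝ, E4)) ((⊤ : ℕ∞) : WithTop ℕ∞)
        (fun x ↦ (Bundle.TotalSpace.mk' E4 x (L x) : TangentBundle (𝓡 4) 𝓑.carrier)) D →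
      (∀ x ∈ D, VectorField.mlieBracket (𝓡 4) 𝓑.killing L x = 0) →
      ∀ p ∈ D, ∀ t : ℝ, mfderiv (𝓡 4) (𝓡 4) (fun q ↦ θ (t, q)) p (L p) = L (θ (t, p)) := by
  intro 𝓑 _ hreg θ D L hθ hθ0 hθadd hθT hD hDdoc hDinv hLs hLb p hp t
  have hK : 𝓑.metric.IsKillingField 𝓑.killing := 𝓑.isStationaryKilling.isKillingField
  have hT : ContMDiff (𝓡 4) (𝓡 4).tangent ∞
      (fun x ↦ (⟨x, 𝓑.killing x⟩ : TangentBundle (𝓡 4) 𝓑.carrier)) := hK.contMDiff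
  have hθ' : ContMDiff (𝓘(ℝ, ℝ).prod (𝓡 4)) (𝓡 4) ∞ θ := hθ
  have hθ2 : ContMDiff (𝓘(ℝ, ℝ).prod (𝓡 4)) (𝓡 4) 2 θ :=
    hθ'.of_le (ENat.LEInfty.out : (2 : ℕ∞ω) ≤ ∞)
  exact mfderiv_flow_apply_eq_of_invariant (V := 𝓑.killing) (W := L) hT hD hLs hLb hθ2 hθT hθ0
    hθadd hDinv (fun q hq ↦ hreg.killing_ne_zero_of_mem_doc (hDdoc hq)) hp t

end Summit.FinalStateConjecture.FinalStateConjecture.Theorems.NonTrappingHawkingRigidity.AzimuthalPartialAnalyticity.SlabPatching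

end
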